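import Mathlib
import Summits.Ventures.PercRepro2.K5Hyper

/-!
# THE `K₅` CERTIFICATE MACHINERY IN BASE `2^25`: THE DEFINITIONS
(blind cell PercRepro2, typer-1 g10; for the crux kernel's `TvT-TRI` certificates, whose coefficient bound
`300 · 3^10 ≈ 17.7 M` exceeds the base `2^23` of `K5Hyper.lean`)

`K5Hyper.lean` in base `KB5 = 2^25` (mask bit `24`): the tree `go3b5` over the same bit tables, `kron35`, `mask5`,
`CertLE5`.  Kept import-light (the certificate files import only this, `K5HyperI` and `K5K3Kernel`); the
identities and the digit argument are `K5HyperB25.lean`.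
-/

namespace Summit.Ventures.PercRepro2

namespace K5

/-- The base `2^25` of the comparison certificates (digits `< 2^24`). -/
def KB5 : ℕ := 2 ^ 25

/-- The Kronecker tree in base `KB5` of a bit table `B` seen through the forced-open mask `S`
(the leaf reads the bit of `ω ∨ S`). -/
def go3b5 (B : ℕ) (S : Fin 10 → Bool) : ℕ → (Fin 10 → Bool) → ℕ
  | 0, ω => (B.testBit (idx2 (orOn S ω))).toNat
  | n + 1, ω => go3b5 B S n (Function.update ω (Fin.ofNat 10 n) false) +
      KB5 ^ (4 ^ n) * go3b5 B S n (Function.update ω (Fin.ofNat 10 n) true)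

/-- The Kronecker number of the table `T` through the mask `S`, via the bit table. -/
def kron35 (T : (Fin 10 → Bool) → Bool) (S : Fin 10 → Bool) : ℕ := go3b5 (bits T) S 10 (fun _ => false)

/-- The mask: bit `24` of every base-`KB5` digit below `4^10`. -/
def mask5 : ℕ := 2 ^ 24 * ((KB5 ^ (4 ^ 10) - 1) / (KB5 - 1))

/-- The certificate shape: `kNeg ≤ kPos` digitwise, witnessed by `kNeg ≤ kPos` and the two mask tests
(no borrow anywhere). -/
def CertLE5 (kNeg kPos : ℕ) : Prop :=
  kNeg ≤ kPos ∧ Nat.land (kPos - kNeg) mask5 = 0 ∧ Nat.land kNeg mask5 = 0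


end K5

end Summit.Ventures.PercRepro2
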